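import Mathlib.Data.ZMod.Basic
import Mathlib.Algebra.BigOperators.Fin
import Mathlib.Data.Fin.VecNotation
import Mathlib.Tactic.LinearCombination
import Literature.Computability.AlgebraicComplexity.MatrixMultiplicationExponent
import HarnessLib

/-!
# Sign lifts of `ℤ₂`-schemes: a parity obstruction, and the printed non-liftable `⟨3,3,3⟩` scheme of Heule–Kauers–Seidl

Topic `Literature/Computability/AlgebraicComplexity`, over `triad` / `matMulTensor` / `tensorRank` of
`MatrixMultiplicationExponent.lean` (Bläser's conventions: `matMulTensor K k m n a b c` with `a = (κ,ν)` the
output position, `b = (κ,μ)` the `A`-position, `c = (μ,ν)` the `B`-position).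

Source: M. J. H. Heule, M. Kauers, M. Seidl, *New ways to multiply `3 × 3`-matrices*, J. Symbolic
Comput. 104 (2021) 899–916 = arXiv:1905.10192 [HeuleKauersSeidl2021]. §6 ("lifting") explains that a
solution of the Brent equations over `ℤ₂` is turned into a solution over `ℤ` (hence over every ring) by
"replacing some of the `1`'s by `-1`'s" (a *signing*), that this almost always succeeds, and that "we
have seen a small number of instances where it fails. One such example is given in the appendix". The
appendix (arXiv:1905.10192, second item) prints that example verbatim:

> "A multiplication scheme for the coefficient ring `ℤ₂` that cannot be extended to a scheme for `ℤ` by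
> replacing some of the `1`'s by `-1`'s. It may still be possible to find a scheme with coefficients in
> `ℤ` which reduces to this scheme modulo `2`, but any such scheme must have at least one coefficient
> with absolute value `≥ 2`."

followed by `23` rank-one tensors `A_ℓ ⊗ B_ℓ ⊗ C_ℓ` with `0/1` entries (HKS convention
`∑_ℓ A_ℓ ⊗ B_ℓ ⊗ C_ℓ = ∑_{i,j,k} E_{ij} ⊗ E_{jk} ⊗ E_{ki}`, §7, i.e. `C` carries the transposed output
index; the tree's slot 1 is `C_ℓᵀ`, slot 2 is `A_ℓ`, slot 3 is `B_ℓ`).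

## What is proved here (everything; no named facts)

* §1 **A parity obstruction to signing** (general; any finite index types, any integer target tensor
  `t`, any `0/1` support pattern `(P_W, P_U, P_V)`). A *signing* of the pattern is an integer family
  `(w, u, v)` with `w = 0` where `P_W = 0` and `w = ±1` where `P_W ≠ 0` (likewise `u`, `v`). For an
  entry `q = (a,b,c)` let `L_q` be the set of summands `ℓ` whose three pattern entries at `q` are
  non-zero (the only summands contributing to the entry `q` of `∑_ℓ w_ℓ ⊗ u_ℓ ⊗ v_ℓ`). Since
  `xyz ≡ x + y + z − 2 (mod 4)` for `x, y, z ∈ {±1}`, a signing that decomposes `t` satisfies, for every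
  finite set `Q` of entries, `∑_{q∈Q} t_q ≡ ∑_{q∈Q} ∑_{ℓ∈L_q} (w_ℓ(a_q) + u_ℓ(b_q) + v_ℓ(c_q)) − 2∑_q |L_q|
  (mod 4)`; if every sign variable `w_ℓ(a)`, `u_ℓ(b)`, `v_ℓ(c)` occurs an EVEN number of times in this
  double sum, each contributes its multiplicity (mod 4) whatever its sign, so the right-hand side is
  `∑_q |L_q| (mod 4)`. Hence the decidable **certificate** `SignLift.ParityCert t P_W P_U P_V Q` — all
  occurrence multiplicities even and `∑_{q∈Q} (t_q − |L_q|) ≢ 0 (mod 4)` — refutes every signing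
  (`SignLift.not_eq_sum_triad`). (For `|L_q| = 2`, `t_q = 0` this is the familiar observation that a
  two-term Brent equation forces the product of its six signs to be `−1`.) [folklore; the mod-4
  bookkeeping is ours, recorded as the proof of the printed claim below]
* §2 **The printed scheme** (`HKS.tabA/tabB/tabC`, verbatim, in printed order; tree slots
  `HKS.patW/patU/patV`): it solves all `729` Brent equations modulo `2` (`HKS.brent_mod_two`, kernel
  evaluation), so it is a `⟨3,3,3⟩`-scheme of rank `23` over `ℤ₂` (`HKS.scheme_mod_two`); the `17`
  two-term Brent equations `HKS.cert` form a parity certificate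
  (`HKS.parityCert`, kernel evaluation); hence **no signing of it is a scheme over `ℤ`**
  (`heuleKauersSeidl2021_appendix_not_signable`) and **every integer scheme reducing to it modulo `2`
  has a coefficient of absolute value `≥ 2`** (`heuleKauersSeidl2021_appendix_two_le_abs_coeff`) — the
  two printed sentences.

HONEST FRAMING: a finite statement about one printed `23`-term `ℤ₂`-scheme and a general sufficient
criterion for non-signability; nothing here bears on the rank of `⟨3,3,3⟩` (which is `≤ 23` over every
ring by Laderman 1976, `SmallFormatRankLaderman.lean`). The paper established the non-signability by
computation (§6: Gröbner bases / SAT); the certificate `HKS.cert` was found by Gaussian elimination over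
`𝔽₂` outside Lean and is CHECKED here by the kernel. Whether this scheme lifts to `ℤ` with larger
coefficients is left open in the source and here.

## References

* M. J. H. Heule, M. Kauers, M. Seidl, *New ways to multiply `3 × 3`-matrices*, J. Symbolic Comput.
  104 (2021) 899–916, arXiv:1905.10192: §6 (signing), §7 (convention `∑ E_{ij}⊗E_{jk}⊗E_{ki}`),
  Appendix, second item (the scheme). [HeuleKauersSeidl2021]
* M. Kauers, J. Moosbauer, *Flip graphs for matrix multiplication*, ISSAC 2023, arXiv:2212.01175, §5
  (lifting `ℤ₂`-schemes; "This leads to a linear system over `ℤ₂`"). [KauersMoosbauer2022FlipGraphs]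
-/

namespace Literature.Computability.AlgebraicComplexity

open scoped BigOperators
open Finset

/-! ## §1 The parity obstruction to signing a `0/1` pattern -/

namespace SignLift

section General

variable {σ : Type*} [Fintype σ] {ι κ μ : Type*}

/-- `a` is a **signing** of the integer pattern `P` (same summand index `ℓ : σ`, same positions):
`a = 0` where `P = 0`, and `a ∈ {1, -1}` where `P ≠ 0` ("replacing some of the `1`'s by `-1`'s").
[cite: HeuleKauersSeidl2021, §6 and Appendix (second item)] -/
def IsSigning {α : Type*} (P a : σ → α → ℤ) : Prop :=
  ∀ l x, (P l x = 0 → a l x = 0) ∧ (P l x ≠ 0 → a l x = 1 ∨ a l x = -1)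

/-- Summand `l` *survives* at the entry `q = (a,b,c)`: its three pattern entries there are non-zero
(only such summands contribute to the entry `q` of a signing). Proof device for the printed
non-signability claim. [cite: HeuleKauersSeidl2021, §6 and Appendix (second item)] -/
def Survives (PW : σ → ι → ℤ) (PU : σ → κ → ℤ) (PV : σ → μ → ℤ) (l : σ) (q : ι × κ × μ) : Prop :=
  PW l q.1 ≠ 0 ∧ PU l q.2.1 ≠ 0 ∧ PV l q.2.2 ≠ 0

/-- Survival is decidable (integer comparisons). [folklore] -/
instance (PW : σ → ι → ℤ) (PU : σ → κ → ℤ) (PV : σ → μ → ℤ) (l : σ) (q : ι × κ × μ) :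
    Decidable (Survives PW PU PV l q) := by
  unfold Survives; infer_instance

/-- The set `L_q` of summands surviving at the entry `q`. [folklore] -/
def survivors (PW : σ → ι → ℤ) (PU : σ → κ → ℤ) (PV : σ → μ → ℤ) (q : ι × κ × μ) : Finset σ :=
  univ.filter fun l => Survives PW PU PV l q

/-- Occurrence multiplicity: the number of entries `q ∈ Q` with slot-coordinate `π q = x` at which the
summand `l` survives, i.e. how often the sign variable of summand `l` at position `x` (in the slot
read by `π`) occurs in `∑_{q∈Q} ∑_{ℓ∈L_q}`. [folklore] -/
def count {α : Type*} [DecidableEq α] (PW : σ → ι → ℤ) (PU : σ → κ → ℤ) (PV : σ → μ → ℤ)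
    (π : ι × κ × μ → α) (Q : Finset (ι × κ × μ)) (l : σ) (x : α) : ℕ :=
  (Q.filter fun q => Survives PW PU PV l q ∧ π q = x).card

/-- **Parity certificate** for the target tensor `t`, the pattern `(P_W, P_U, P_V)` and a finite set
`Q` of entries: every sign variable occurs an even number of times in `∑_{q∈Q} ∑_{ℓ∈L_q}` (all three
slots) and `∑_{q∈Q} (t_q − |L_q|) ≢ 0 (mod 4)`. Decidable. Proof device (ours) for the printed
non-signability claim; the source reports a computation (Gröbner bases / SAT, §6).
[cite: HeuleKauersSeidl2021, §6 and Appendix (second item)] -/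
def ParityCert [Fintype ι] [Fintype κ] [Fintype μ] [DecidableEq ι] [DecidableEq κ] [DecidableEq μ]
    (t : ι → κ → μ → ℤ) (PW : σ → ι → ℤ) (PU : σ → κ → ℤ) (PV : σ → μ → ℤ)
    (Q : Finset (ι × κ × μ)) : Prop :=
  (∀ l x, Even (count PW PU PV Prod.fst Q l x)) ∧
    (∀ l x, Even (count PW PU PV (fun q => q.2.1) Q l x)) ∧
    (∀ l x, Even (count PW PU PV (fun q => q.2.2) Q l x)) ∧
    (∑ q ∈ Q, (t q.1 q.2.1 q.2.2 - ((survivors PW PU PV q).card : ℤ))) % 4 ≠ 0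

/-- Parity certificates are decidable (finite counting), so instances are checked by `decide`.
[folklore] -/
instance [Fintype ι] [Fintype κ] [Fintype μ] [DecidableEq ι] [DecidableEq κ] [DecidableEq μ]
    (t : ι → κ → μ → ℤ) (PW : σ → ι → ℤ) (PU : σ → κ → ℤ) (PV : σ → μ → ℤ)
    (Q : Finset (ι × κ × μ)) : Decidable (ParityCert t PW PU PV Q) := by
  unfold ParityCert; infer_instance


variable {PW : σ → ι → ℤ} {PU : σ → κ → ℤ} {PV : σ → μ → ℤ}
  {w : σ → ι → ℤ} {u : σ → κ → ℤ} {v : σ → μ → ℤ}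
/-- Membership in `L_q`. [folklore] -/
private theorem mem_survivors {l : σ} {q : ι × κ × μ} :
    l ∈ survivors PW PU PV q ↔ Survives PW PU PV l q := by
  simp [survivors]

/-- The entry `(a,b,c)` of `∑_ℓ w_ℓ ⊗ u_ℓ ⊗ v_ℓ` for a signing only sees the surviving summands.
[folklore] -/
private theorem sum_triad_apply (hw : IsSigning PW w) (hu : IsSigning PU u) (hv : IsSigning PV v)
    (a : ι) (b : κ) (c : μ) :
    (∑ l, triad (w l) (u l) (v l)) a b c =
      ∑ l ∈ survivors PW PU PV (a, b, c), w l a * u l b * v l c := by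
  rw [Finset.sum_apply, Finset.sum_apply, Finset.sum_apply, survivors, Finset.sum_filter]
  refine Finset.sum_congr rfl fun l _ => ?_
  rw [triad_apply]
  split_ifs with h
  · rfl
  · simp only [Survives, not_and_or, not_not] at h
    rcases h with h | h | h
    · rw [(hw l a).1 h, zero_mul, zero_mul]
    · rw [(hu l b).1 h, mul_zero, zero_mul]
    · rw [(hv l c).1 h, mul_zero]

/-- `4 = 0` in `ℤ/4`. [folklore] -/
private theorem four_eq_zero : (4 : ZMod 4) = 0 := by decide

/-- The mod-`4` identity behind the obstruction: `xyz ≡ x + y + z − 2 (mod 4)` for signs `x, y, z`.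
[folklore] -/
private theorem cast_mul_of_sign {x y z : ℤ} (hx : x = 1 ∨ x = -1) (hy : y = 1 ∨ y = -1)
    (hz : z = 1 ∨ z = -1) :
    ((x * y * z : ℤ) : ZMod 4) = (x : ZMod 4) + (y : ZMod 4) + (z : ZMod 4) - 2 := by
  rcases hx with rfl | rfl <;> rcases hy with rfl | rfl <;> rcases hz with rfl | rfl <;>
    push_cast <;> decide

/-- An even multiple of a sign is that multiple of `1`, modulo `4`. [folklore] -/
private theorem even_smul_sign {n : ℕ} (hn : Even n) {s : ℤ} (hs : s = 1 ∨ s = -1) :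
    n • ((s : ℤ) : ZMod 4) = (n : ZMod 4) := by
  obtain ⟨k, rfl⟩ := hn
  rcases hs with rfl | rfl
  · rw [nsmul_eq_mul]; push_cast; ring
  · rw [nsmul_eq_mul]; push_cast; linear_combination (-(k : ZMod 4)) * four_eq_zero

/-- Entry `q` of a signing decomposition, modulo `4`:
`t_q ≡ ∑_{ℓ∈L_q} (w_ℓ(a) + u_ℓ(b) + v_ℓ(c)) − 2|L_q|`. [folklore] -/
private theorem cast_apply_of_eq {t : ι → κ → μ → ℤ} (hw : IsSigning PW w) (hu : IsSigning PU u)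
    (hv : IsSigning PV v) (ht : t = ∑ l, triad (w l) (u l) (v l)) (q : ι × κ × μ) :
    ((t q.1 q.2.1 q.2.2 : ℤ) : ZMod 4) =
      (∑ l ∈ survivors PW PU PV q,
          (((w l q.1 : ℤ) : ZMod 4) + ((u l q.2.1 : ℤ) : ZMod 4) + ((v l q.2.2 : ℤ) : ZMod 4))) -
        2 * ((survivors PW PU PV q).card : ZMod 4) := by
  obtain ⟨a, b, c⟩ := q
  rw [ht, sum_triad_apply hw hu hv, Int.cast_sum]
  have key : ∀ l ∈ survivors PW PU PV (a, b, c), ((w l a * u l b * v l c : ℤ) : ZMod 4) =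
      ((w l a : ℤ) : ZMod 4) + ((u l b : ℤ) : ZMod 4) + ((v l c : ℤ) : ZMod 4) - 2 := by
    intro l hl
    rw [mem_survivors] at hl
    exact cast_mul_of_sign ((hw l a).2 hl.1) ((hu l b).2 hl.2.1) ((hv l c).2 hl.2.2)
  rw [Finset.sum_congr rfl key, Finset.sum_sub_distrib, Finset.sum_const, nsmul_eq_mul]
  ring

/-- Exchange of summation: `∑_{q∈Q} ∑_{ℓ∈L_q} f ℓ (π q) = ∑_ℓ ∑_x count_π(ℓ,x) • f ℓ x`. [folklore] -/
private theorem sum_sum_survivors {M : Type*} [AddCommMonoid M] {α : Type*} [Fintype α] [DecidableEq α]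
    (π : ι × κ × μ → α) (f : σ → α → M) (Q : Finset (ι × κ × μ)) :
    ∑ q ∈ Q, ∑ l ∈ survivors PW PU PV q, f l (π q) =
      ∑ l, ∑ x, count PW PU PV π Q l x • f l x := by
  have h1 : ∀ q ∈ Q, ∑ l ∈ survivors PW PU PV q, f l (π q) =
      ∑ l, if Survives PW PU PV l q then f l (π q) else 0 := fun q _ => by
    rw [survivors, Finset.sum_filter]
  rw [Finset.sum_congr rfl h1, Finset.sum_comm]
  refine Finset.sum_congr rfl fun l _ => ?_
  have h2 : ∀ x ∈ (univ : Finset α), count PW PU PV π Q l x • f l x =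
      ∑ q ∈ Q, if Survives PW PU PV l q ∧ π q = x then f l x else 0 := fun x _ => by
    rw [count, ← Finset.sum_const, Finset.sum_filter]
  rw [Finset.sum_congr rfl h2, Finset.sum_comm]
  refine Finset.sum_congr rfl fun q _ => ?_
  by_cases hS : Survives PW PU PV l q
  · simp [hS]
  · simp [hS]

/-- With even multiplicities, the slot-`π` double sum of a signing is the total multiplicity (mod `4`).
[folklore] -/
private theorem sum_count_smul {α : Type*} [Fintype α] [DecidableEq α] {P a : σ → α → ℤ}
    (ha : IsSigning P a) (π : ι × κ × μ → α) (hπ : ∀ l q, Survives PW PU PV l q → P l (π q) ≠ 0)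
    {Q : Finset (ι × κ × μ)} (hQ : ∀ l x, Even (count PW PU PV π Q l x)) :
    ∑ l, ∑ x, count PW PU PV π Q l x • ((a l x : ℤ) : ZMod 4) =
      ∑ l, ∑ x, (count PW PU PV π Q l x : ZMod 4) := by
  refine Finset.sum_congr rfl fun l _ => Finset.sum_congr rfl fun x _ => ?_
  by_cases h : P l x = 0
  · have h0 : count PW PU PV π Q l x = 0 :=
      Finset.card_eq_zero.mpr (Finset.filter_eq_empty_iff.mpr fun q _ hq =>
        hπ l q hq.1 (by rw [hq.2]; exact h))
    rw [h0, zero_nsmul, Nat.cast_zero]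
  · exact even_smul_sign (hQ l x) ((ha l x).2 h)

/-- `∑_{q∈Q} |L_q|` is the total multiplicity of any slot (mod `4`). [folklore] -/
private theorem sum_card_survivors {α : Type*} [Fintype α] [DecidableEq α] (π : ι × κ × μ → α)
    (Q : Finset (ι × κ × μ)) :
    ∑ q ∈ Q, ((survivors PW PU PV q).card : ZMod 4) =
      ∑ l, ∑ x, (count PW PU PV π Q l x : ZMod 4) := by
  have h := sum_sum_survivors (PW := PW) (PU := PU) (PV := PV) π (fun _ _ => (1 : ZMod 4)) Q
  simpa [nsmul_eq_mul] using h

/-- **Soundness of parity certificates**: if `ParityCert t P_W P_U P_V Q` holds then no signing of the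
pattern is a decomposition of `t`. Proof: the mod-`4` bookkeeping described in the module docstring
(ours; the source establishes its instance by computation). This is the proof OF the printed claim
`heuleKauersSeidl2021_appendix_not_signable` below, stated for an arbitrary pattern.
[cite: HeuleKauersSeidl2021, §6 and Appendix (second item)] -/
theorem not_eq_sum_triad [Fintype ι] [Fintype κ] [Fintype μ] [DecidableEq ι] [DecidableEq κ]
    [DecidableEq μ] {t : ι → κ → μ → ℤ} {Q : Finset (ι × κ × μ)}
    (hQ : ParityCert t PW PU PV Q) (hw : IsSigning PW w) (hu : IsSigning PU u)
    (hv : IsSigning PV v) : t ≠ ∑ l, triad (w l) (u l) (v l) := by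
  intro ht
  obtain ⟨hcW, hcU, hcV, hsum⟩ := hQ
  have h0 : ((∑ q ∈ Q, (t q.1 q.2.1 q.2.2 - ((survivors PW PU PV q).card : ℤ)) : ℤ) : ZMod 4)
      = 0 := by
    rw [Int.cast_sum]
    simp only [Int.cast_sub, Int.cast_natCast]
    rw [Finset.sum_sub_distrib, sub_eq_zero]
    have key : ∀ q ∈ Q, ((t q.1 q.2.1 q.2.2 : ℤ) : ZMod 4) =
        (∑ l ∈ survivors PW PU PV q,
            (((w l q.1 : ℤ) : ZMod 4) + ((u l q.2.1 : ℤ) : ZMod 4) + ((v l q.2.2 : ℤ) : ZMod 4))) -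
          2 * ((survivors PW PU PV q).card : ZMod 4) := fun q _ => cast_apply_of_eq hw hu hv ht q
    rw [Finset.sum_congr rfl key, Finset.sum_sub_distrib]
    simp only [Finset.sum_add_distrib]
    have hW : ∑ q ∈ Q, ∑ l ∈ survivors PW PU PV q, ((w l q.1 : ℤ) : ZMod 4) =
        ∑ l, ∑ x, count PW PU PV Prod.fst Q l x • ((w l x : ℤ) : ZMod 4) :=
      sum_sum_survivors Prod.fst (fun l x => ((w l x : ℤ) : ZMod 4)) Q
    have hU : ∑ q ∈ Q, ∑ l ∈ survivors PW PU PV q, ((u l q.2.1 : ℤ) : ZMod 4) =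
        ∑ l, ∑ x, count PW PU PV (fun q => q.2.1) Q l x • ((u l x : ℤ) : ZMod 4) :=
      sum_sum_survivors (fun q => q.2.1) (fun l x => ((u l x : ℤ) : ZMod 4)) Q
    have hV : ∑ q ∈ Q, ∑ l ∈ survivors PW PU PV q, ((v l q.2.2 : ℤ) : ZMod 4) =
        ∑ l, ∑ x, count PW PU PV (fun q => q.2.2) Q l x • ((v l x : ℤ) : ZMod 4) :=
      sum_sum_survivors (fun q => q.2.2) (fun l x => ((v l x : ℤ) : ZMod 4)) Q
    rw [hW, hU, hV, sum_count_smul hw Prod.fst (fun l q h => h.1) hcW,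
      sum_count_smul hu (fun q => q.2.1) (fun l q h => h.2.1) hcU,
      sum_count_smul hv (fun q => q.2.2) (fun l q h => h.2.2) hcV,
      ← sum_card_survivors Prod.fst Q, ← sum_card_survivors (fun q => q.2.1) Q,
      ← sum_card_survivors (fun q => q.2.2) Q, ← Finset.mul_sum]
    ring
  have h4 := (ZMod.intCast_zmod_eq_zero_iff_dvd _ 4).1 h0
  exact hsum (Int.emod_eq_zero_of_dvd (by exact_mod_cast h4))

omit [Fintype σ] in
/-- Equivalent reading used for the second printed sentence: an integer family that reduces modulo `2`
to a `0/1` pattern and has all entries of absolute value `≤ 1` is a signing of the pattern.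
[cite: HeuleKauersSeidl2021, Appendix (second item, second sentence)] -/
theorem isSigning_of_abs_lt_two {α : Type*} {P a : σ → α → ℤ} (hP : ∀ l x, P l x = 0 ∨ P l x = 1)
    (ha : ∀ l x, ((a l x : ℤ) : ZMod 2) = ((P l x : ℤ) : ZMod 2)) (hlt : ∀ l x, |a l x| < 2) :
    IsSigning P a := by
  intro l x
  have hx := ha l x
  have h2 := abs_lt.1 (hlt l x)
  rcases hP l x with h0 | h1
  · rw [h0, Int.cast_zero, ZMod.intCast_zmod_eq_zero_iff_dvd] at hx
    obtain ⟨k, hk⟩ := hx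
    exact ⟨fun _ => by omega, fun h => (h h0).elim⟩
  · rw [h1] at hx
    obtain ⟨k, hk⟩ := (ZMod.intCast_eq_intCast_iff_dvd_sub (a l x) 1 2).1 hx
    exact ⟨fun h => by omega, fun _ => by omega⟩

end General

end SignLift

/-! ## §2 The printed `ℤ₂`-scheme of Heule–Kauers–Seidl that admits no signing -/

namespace HKS

open SignLift

/-- The `A`-factors `A_ℓ` (`3 × 3`, row `i`, column `j` = coefficient of `a_{ij}`) of the `23` printed
summands, verbatim and in printed order.
[cite: HeuleKauersSeidl2021, Appendix (second item), arXiv:1905.10192] -/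
def tabA : Fin 23 → Fin 3 → Fin 3 → ℤ := ![
  ![![0, 0, 0], ![0, 0, 0], ![1, 0, 0]], ![![0, 0, 0], ![0, 0, 0], ![0, 0, 1]],
  ![![0, 0, 0], ![0, 0, 0], ![0, 1, 1]], ![![0, 0, 0], ![1, 0, 0], ![0, 0, 0]],
  ![![0, 0, 0], ![1, 0, 0], ![1, 0, 0]], ![![0, 0, 0], ![1, 0, 0], ![1, 0, 0]],
  ![![0, 0, 0], ![0, 1, 0], ![0, 0, 0]], ![![0, 0, 0], ![0, 1, 0], ![1, 0, 0]],
  ![![0, 0, 0], ![0, 1, 0], ![0, 1, 0]], ![![0, 0, 0], ![0, 1, 0], ![0, 0, 1]],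
  ![![0, 0, 0], ![0, 0, 1], ![0, 0, 1]], ![![0, 0, 0], ![0, 1, 1], ![0, 0, 0]],
  ![![1, 0, 0], ![0, 0, 0], ![0, 0, 0]], ![![1, 0, 0], ![0, 0, 0], ![1, 0, 0]],
  ![![0, 1, 0], ![0, 0, 0], ![0, 0, 0]], ![![1, 1, 0], ![0, 0, 0], ![0, 0, 0]],
  ![![1, 1, 0], ![0, 0, 0], ![1, 1, 0]], ![![1, 1, 0], ![0, 0, 0], ![1, 0, 1]],
  ![![0, 0, 1], ![0, 0, 0], ![0, 0, 1]], ![![0, 1, 1], ![0, 1, 1], ![0, 0, 0]],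
  ![![1, 1, 1], ![0, 0, 0], ![0, 0, 0]], ![![1, 1, 1], ![1, 0, 1], ![0, 0, 0]],
  ![![1, 1, 1], ![0, 1, 1], ![0, 0, 0]]]

/-- The `B`-factors `B_ℓ` of the `23` printed summands (coefficient of `b_{jk}` in row `j`, column `k`).
[cite: HeuleKauersSeidl2021, Appendix (second item), arXiv:1905.10192] -/
def tabB : Fin 23 → Fin 3 → Fin 3 → ℤ := ![
  ![![0, 1, 0], ![0, 1, 0], ![0, 1, 0]], ![![0, 0, 0], ![1, 0, 0], ![1, 0, 0]],
  ![![0, 0, 0], ![1, 0, 0], ![0, 0, 0]], ![![1, 0, 0], ![0, 0, 0], ![0, 0, 0]],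
  ![![1, 0, 0], ![0, 0, 0], ![0, 0, 0]], ![![0, 0, 1], ![0, 0, 0], ![0, 0, 0]],
  ![![0, 1, 1], ![0, 1, 1], ![0, 1, 1]], ![![0, 1, 1], ![0, 1, 0], ![0, 1, 0]],
  ![![0, 0, 0], ![1, 0, 1], ![0, 0, 0]], ![![0, 0, 0], ![1, 0, 0], ![0, 0, 1]],
  ![![0, 0, 0], ![0, 0, 0], ![1, 0, 1]], ![![0, 0, 0], ![0, 0, 0], ![0, 0, 1]],
  ![![0, 1, 0], ![0, 1, 0], ![0, 0, 0]], ![![1, 1, 0], ![1, 1, 0], ![0, 0, 0]],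
  ![![0, 0, 0], ![0, 1, 1], ![0, 1, 1]], ![![0, 0, 0], ![0, 1, 0], ![0, 1, 0]],
  ![![0, 0, 0], ![1, 1, 0], ![0, 0, 0]], ![![0, 0, 0], ![1, 0, 0], ![0, 1, 0]],
  ![![0, 0, 0], ![0, 0, 0], ![1, 1, 0]], ![![0, 1, 1], ![0, 0, 0], ![0, 1, 1]],
  ![![0, 0, 0], ![0, 0, 0], ![0, 1, 0]], ![![0, 1, 1], ![0, 0, 0], ![0, 0, 0]],
  ![![0, 1, 1], ![0, 0, 0], ![0, 1, 0]]]

/-- The `C`-factors `C_ℓ` of the `23` printed summands (coefficient of `c_{ki}` in row `k`, column `i`;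
HKS convention `∑ E_{ij}⊗E_{jk}⊗E_{ki}`, so `C` carries the TRANSPOSED output index).
[cite: HeuleKauersSeidl2021, Appendix (second item), arXiv:1905.10192] -/
def tabC : Fin 23 → Fin 3 → Fin 3 → ℤ := ![
  ![![1, 0, 0], ![0, 1, 1], ![0, 1, 1]], ![![1, 1, 1], ![0, 0, 0], ![0, 0, 0]],
  ![![0, 0, 1], ![0, 0, 1], ![0, 0, 1]], ![![1, 1, 1], ![0, 0, 0], ![0, 0, 0]],
  ![![1, 0, 1], ![0, 0, 0], ![0, 0, 0]], ![![0, 0, 0], ![0, 1, 0], ![0, 1, 0]],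
  ![![0, 0, 0], ![0, 0, 0], ![0, 1, 1]], ![![0, 0, 0], ![0, 1, 0], ![0, 1, 1]],
  ![![0, 0, 0], ![0, 0, 0], ![0, 0, 1]], ![![0, 1, 0], ![0, 0, 0], ![0, 0, 1]],
  ![![0, 1, 0], ![0, 0, 0], ![0, 0, 0]], ![![0, 1, 0], ![0, 0, 0], ![1, 1, 0]],
  ![![1, 0, 0], ![1, 0, 0], ![1, 0, 0]], ![![1, 0, 0], ![0, 0, 0], ![0, 0, 0]],
  ![![0, 0, 0], ![0, 0, 0], ![1, 0, 0]], ![![0, 0, 0], ![1, 0, 1], ![1, 0, 0]],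
  ![![0, 0, 0], ![0, 0, 1], ![0, 0, 0]], ![![1, 0, 0], ![0, 0, 1], ![0, 0, 0]],
  ![![1, 0, 0], ![0, 0, 0], ![0, 0, 0]], ![![0, 0, 0], ![0, 0, 0], ![1, 0, 0]],
  ![![1, 0, 0], ![1, 1, 0], ![0, 0, 0]], ![![0, 0, 0], ![0, 1, 0], ![0, 0, 0]],
  ![![0, 0, 0], ![0, 1, 0], ![1, 0, 0]]]

/-- Tree slot 1 (output position `(κ,ν)`): `C_ℓᵀ`. [cite: HeuleKauersSeidl2021, Appendix (second item)] -/
def patW (l : Fin 23) (p : Fin 3 × Fin 3) : ℤ := tabC l p.2 p.1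

/-- Tree slot 2 (`A`-position `(κ,μ)`): `A_ℓ`. [cite: HeuleKauersSeidl2021, Appendix (second item)] -/
def patU (l : Fin 23) (p : Fin 3 × Fin 3) : ℤ := tabA l p.1 p.2

/-- Tree slot 3 (`B`-position `(μ,ν)`): `B_ℓ`. [cite: HeuleKauersSeidl2021, Appendix (second item)] -/
def patV (l : Fin 23) (p : Fin 3 × Fin 3) : ℤ := tabB l p.1 p.2

/-- The printed tables are `0/1` tables. [cite: HeuleKauersSeidl2021, Appendix (second item)] -/
theorem pat_zero_or_one : (∀ l x, patW l x = 0 ∨ patW l x = 1) ∧ (∀ l x, patU l x = 0 ∨ patU l x = 1) ∧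
    (∀ l x, patV l x = 0 ∨ patV l x = 1) := by
  decide
set_option maxHeartbeats 400000 in -- buildfix (bf3-g31): 160k/180k FAIL, 200k PASS at accept time; line-neutral budget line
/-- "A multiplication scheme for the coefficient ring `ℤ₂`": all `729` Brent equations hold modulo `2`
for the printed tables (kernel evaluation). [cite: HeuleKauersSeidl2021, Appendix (second item)] -/
theorem brent_mod_two : ∀ a b c : Fin 3 × Fin 3,
    (∑ l, patW l a * patU l b * patV l c - matMulTensor ℤ 3 3 3 a b c) % 2 = 0 := by
  decide

/-- The printed scheme as a tensor decomposition of `⟨3,3,3⟩` over `ℤ₂`.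
[cite: HeuleKauersSeidl2021, Appendix (second item)] -/
theorem scheme_mod_two : matMulTensor (ZMod 2) 3 3 3 =
    ∑ l, triad (fun a => ((patW l a : ℤ) : ZMod 2)) (fun b => ((patU l b : ℤ) : ZMod 2))
      (fun c => ((patV l c : ℤ) : ZMod 2)) := by
  funext a b c
  rw [Finset.sum_apply, Finset.sum_apply, Finset.sum_apply]
  simp only [triad_apply]
  have hd : ((2 : ℕ) : ℤ) ∣ matMulTensor ℤ 3 3 3 a b c - ∑ l, patW l a * patU l b * patV l c := by
    have h := Int.dvd_of_emod_eq_zero (brent_mod_two a b c)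
    exact_mod_cast dvd_sub_comm.1 h
  have hc := (ZMod.intCast_eq_intCast_iff_dvd_sub _ _ 2).2 hd
  rw [Int.cast_sum] at hc
  simp only [Int.cast_mul] at hc
  rw [hc]
  unfold matMulTensor
  split_ifs <;> simp

/-- The parity certificate: `17` entries of `⟨3,3,3⟩` (tree coordinates `((κ,ν),(κ,μ),(μ,ν))`), each a
Brent equation with right-hand side `0` and exactly two surviving summands, in which every sign variable
occurs an even number of times (found by Gaussian elimination over `𝔽₂` outside Lean; checked below).
[cite: HeuleKauersSeidl2021, Appendix (second item)] -/
def cert : Finset ((Fin 3 × Fin 3) × (Fin 3 × Fin 3) × (Fin 3 × Fin 3)) :=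
  {((0, 0), (0, 0), (0, 1)), ((0, 2), (0, 0), (0, 1)), ((2, 1), (0, 0), (1, 0)),
   ((0, 0), (0, 0), (1, 1)), ((2, 1), (0, 0), (1, 1)), ((0, 2), (0, 0), (1, 1)),
   ((2, 1), (0, 0), (2, 1)), ((0, 2), (0, 0), (2, 1)), ((1, 1), (1, 1), (0, 1)),
   ((1, 1), (1, 1), (2, 1)), ((0, 0), (2, 0), (0, 1)), ((1, 1), (2, 0), (0, 1)),
   ((2, 1), (2, 0), (1, 0)), ((0, 0), (2, 0), (1, 1)), ((2, 1), (2, 0), (1, 1)),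
   ((1, 1), (2, 0), (2, 1)), ((2, 1), (2, 0), (2, 1))}

/-- The certificate checks (kernel evaluation): all occurrence multiplicities are even and
`∑_{q} (t_q − |L_q|) = −34 ≢ 0 (mod 4)`. [cite: HeuleKauersSeidl2021, Appendix (second item)] -/
theorem parityCert : ParityCert (matMulTensor ℤ 3 3 3) patW patU patV cert := by
  decide

/-- **Heule–Kauers–Seidl 2021, Appendix: the printed `ℤ₂`-scheme "cannot be extended to a scheme for `ℤ`
by replacing some of the `1`'s by `-1`'s"** — no signing of its support is a decomposition of `⟨3,3,3⟩`
over `ℤ`. [cite: HeuleKauersSeidl2021, Appendix (second item, first sentence)] -/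
theorem _root_.Literature.Computability.AlgebraicComplexity.heuleKauersSeidl2021_appendix_not_signable :
    ¬ ∃ w u v : Fin 23 → Fin 3 × Fin 3 → ℤ, IsSigning patW w ∧ IsSigning patU u ∧ IsSigning patV v ∧
      matMulTensor ℤ 3 3 3 = ∑ l, triad (w l) (u l) (v l) := by
  rintro ⟨w, u, v, hw, hu, hv, ht⟩
  exact not_eq_sum_triad parityCert hw hu hv ht

/-- **Heule–Kauers–Seidl 2021, Appendix, second sentence**: any integer scheme (`23` summands, same
indexing) that reduces to the printed scheme modulo `2` "must have at least one coefficient with absolute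
value `≥ 2`". [cite: HeuleKauersSeidl2021, Appendix (second item, second sentence)] -/
theorem _root_.Literature.Computability.AlgebraicComplexity.heuleKauersSeidl2021_appendix_two_le_abs_coeff
    {w u v : Fin 23 → Fin 3 × Fin 3 → ℤ}
    (hw : ∀ l x, ((w l x : ℤ) : ZMod 2) = ((patW l x : ℤ) : ZMod 2))
    (hu : ∀ l x, ((u l x : ℤ) : ZMod 2) = ((patU l x : ℤ) : ZMod 2))
    (hv : ∀ l x, ((v l x : ℤ) : ZMod 2) = ((patV l x : ℤ) : ZMod 2))
    (ht : matMulTensor ℤ 3 3 3 = ∑ l, triad (w l) (u l) (v l)) :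
    ∃ l x, 2 ≤ |w l x| ∨ 2 ≤ |u l x| ∨ 2 ≤ |v l x| := by
  by_contra hne
  push Not at hne
  obtain ⟨pW, pU, pV⟩ := pat_zero_or_one
  exact not_eq_sum_triad parityCert (isSigning_of_abs_lt_two pW hw fun l x => (hne l x).1)
    (isSigning_of_abs_lt_two pU hu fun l x => (hne l x).2.1)
    (isSigning_of_abs_lt_two pV hv fun l x => (hne l x).2.2) ht

end HKS

end Literature.Computability.AlgebraicComplexity
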